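import Literature.Topology.FourManifolds.RoundSolidTorusSolidTwist
import Literature.Topology.FourManifolds.HandlebodyKernelExtensionModel
import Literature.Topology.FourManifolds.Homogeneity
import HarnessLib

/-!
# Griffiths' handlebody extension theorem in genus one, from the faithfulness of `Mod(T²)`

Topic `Literature/Topology/FourManifolds`; fourth file on the named fact
`Literature.Topology.FourManifolds.GriffithsExtension` (`HandlebodyKernelExtension.lean`;
H. B. Griffiths, *Automorphisms of a 3-dimensional handlebody*, Abh. Math. Sem. Univ. Hamburg 26
(1964), main theorem; S. Hensel, *A primer on handlebody groups* (2020), Cor. 5.11: a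
self-diffeomorphism `ψ` of the boundary of a genus-`g` handlebody `H` whose action on `π₁(∂H)`
preserves `ker (π₁ ∂H → π₁ H)` extends over `H`), after `HandlebodyKernelExtensionProofs.lean`
(necessity; genus `0`; line A = Waldhausen + recognition of `#ᵍ S¹ × S²`) and
`HandlebodyKernelExtensionModel.lean` (one model per genus suffices, up to diffeotopy).
**Everything here is proved; no definition and no named fact is introduced; the fact is NOT
discharged.**  What lands is **the genus-`1` case of the fact, reduced to the faithfulness of the
action of `Diff(T²)` on `π₁(T²)`** — for the Heegaard torus `∂V` of the round solid torus
`V = RoundSolidTorus ⊂ ℝ³` at its base point `z₀`: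

> (F) every self-diffeomorphism `τ` of `∂V` with `τ z₀ = z₀` and `τ_# = id` on `π₁(∂V, z₀)` is
> diffeotopic to the identity

(Farb–Margalit, *A primer on mapping class groups* (2012), Thm. 2.5: `Mod(T²) → SL(2, ℤ)`,
`[φ] ↦ φ_*` on `H₁(T²) = π₁(T²)`, is INJECTIVE — with Thm. 1.13, smooth and topological mapping
class groups agree; equivalently Earle–Eells (1969): the group of diffeomorphisms of `T²` homotopic
to the identity is connected).  (F) is the genus-`1` instance of the Baer–Epstein–Nielsen
faithfulness half of the Dehn–Nielsen–Baer theorem, whose surjectivity half in genus `1` is proved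
in the tree (`DehnNielsenBaerTorus.lean`); it is not in the tree and is taken here as an explicit
HYPOTHESIS (not as a named fact).

## The argument (Griffiths 1964 in genus one; Farb–Margalit §2.2.4)

Let `χ` be a kernel-preserving self-diffeomorphism of `∂V` (at some base point `y₀`).
* §1 Bookkeeping valid for any manifold with boundary: the kernel condition is preserved under
  composition (`BoundaryData.map_ker_trans`) and has a based form (`map_ker_mapOfEq_eq`).
* §3 Normalisation: by homogeneity (`Diffeomorph.exists_isDiffeotopicToId_apply_eq_euclidean`,
  Hirsch Ch. 8 §3 Thm. 3.1) there are `P₁, P₂ ∈ Diff(∂V)` diffeotopic to the identity with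
  `P₁ z₀ = y₀`, `P₂ (χ y₀) = z₀`; they extend over `V` (collar absorption, the tree's proved
  `BoundaryData.diffeoExtends_of_isDiffeotopicToId_holds`, Hirsch Ch. 8 §2), hence are
  kernel-preserving (necessity, `BoundaryData.DiffeoExtends.map_ker_eq_ker`), so
  `ψ = P₂ ∘ χ ∘ P₁` fixes `z₀`, is kernel-preserving at `z₀`, and extends iff `χ` does.
* §2 **Realisation** (`RoundSolidTorusModel.exists_diffeoExtends_mapOfEq_eq`): the matrix
  `(a b; c d) ∈ GL(2, ℤ)` of `ψ_#` on `π₁(∂V, z₀) = ⟨g₁⟩ × ⟨g₂⟩ ≅ ℤ²` (longitude, meridian;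
  `DehnNielsenBaerTorus.lean`) preserves the kernel `⟨g₂⟩ = ker (π₁ ∂V → π₁ V)`
  (`RoundSolidTorusMeridianKernel.lean`), so `b = 0` (and `b' = 0` for the inverse), whence
  `a, d = ±1`; the linear diffeomorphism `F = M_{(a 0; c d)}` of `∂V` realises `ψ_#`
  (`mapOfEq_boundaryMatrixFun`) and EXTENDS over `V` — by the meridional twist
  `longC ↦ longC^a, merC ↦ longC^c merC` and the mirror `z ↦ −z` (`RoundSolidTorusSolidTwist.lean`).
* §3 `τ = ψ ∘ F⁻¹` fixes `z₀` and acts trivially on `π₁(∂V, z₀)`; by (F) it is diffeotopic to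
  the identity, so extends (collar absorption again); hence `ψ = τ ∘ F` extends, hence `χ` does
  (`RoundSolidTorusModel.diffeoExtends_of_map_ker_eq_ker_of_faithful`).
* §4 By the model reduction (`BoundaryData.diffeoExtends_of_forall_diffeoExtends_of_diffeomorph`,
  uniqueness of genus-`1` handlebodies) **Griffiths' criterion holds for every genus-`1` handlebody
  and every boundary datum, granted (F)** (`griffithsExtension_genus_one_of_faithful`), and
  `GriffithsExtension` itself follows from (F) and the criterion on the flower handlebodies of
  genus `≥ 2` (`griffithsExtension_of_faithful_of_flower`).

## References

* H. B. Griffiths, *Automorphisms of a 3-dimensional handlebody*, Abh. Math. Sem. Univ. Hamburg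
  26 (1964) 191–210, main theorem. [GriffithsHB1964Handlebody]
* S. Hensel, *A primer on handlebody groups*, Handbook of Group Actions V (2020), Cor. 5.11.
  [Hensel2020HandlebodyPrimer]
* B. Farb, D. Margalit, *A primer on mapping class groups*, PMS 49 (2012), Thm. 2.5, §2.2.4,
  Thm. 1.13. [FarbMargalit2012]
* M. W. Hirsch, *Differential Topology* (1976), Ch. 8 §2 (proof of Thm. 2.3), §3 Thm. 3.1.
  [HirschDT1976]
* A. Hatcher, *Algebraic Topology* (2002), §1.1 p. 34, Prop. 1.18. [HatcherAT2002]
-/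

noncomputable section

namespace Literature.Topology.FourManifolds

open Set Function
open scoped _root_.Manifold _root_.ContDiff _root_.Topology
open Literature.AlgebraicTopology.FundamentalGroup

universe u

/-! ### §1 The kernel condition under composition, and its based form -/

section KernelCondition

variable {E H E₀ H₀ : Type*} [NormedAddCommGroup E] [NormedSpace ℝ E] [TopologicalSpace H]
  [NormedAddCommGroup E₀] [NormedSpace ℝ E₀] [TopologicalSpace H₀]
  {I : ModelWithCorners ℝ E H} {M : Type u} [TopologicalSpace M] [ChartedSpace H M]
  {I₀ : ModelWithCorners ℝ E₀ H₀}

/-- **Griffiths' kernel condition is preserved under composition**: if `φ_*` carries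
`N_x = ker (π₁(∂M, x) → π₁ M)` onto `N_{φ x}` and `ψ_*` carries `N_{φ x}` onto `N_{ψ (φ x)}`, then
`(ψ ∘ φ)_*` carries `N_x` onto `N_{ψ (φ x)}` (functoriality of `π₁`, Hatcher §1.1).
[cite: HatcherAT2002, §1.1 (p. 34)] -/
theorem BoundaryData.map_ker_trans (b : BoundaryData I M I₀) {φ ψ : b.carrier ≃ₘ⟮I₀, I₀⟯ b.carrier}
    {x : b.carrier}
    (hφ : ((FundamentalGroup.map (⟨b.incl, b.continuous_incl⟩ : C(b.carrier, M)) x).ker).map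
        (FundamentalGroup.map (⟨φ, φ.continuous⟩ : C(b.carrier, b.carrier)) x) =
      (FundamentalGroup.map (⟨b.incl, b.continuous_incl⟩ : C(b.carrier, M))
        ((⟨φ, φ.continuous⟩ : C(b.carrier, b.carrier)) x)).ker)
    (hψ : ((FundamentalGroup.map (⟨b.incl, b.continuous_incl⟩ : C(b.carrier, M)) (φ x)).ker).map
        (FundamentalGroup.map (⟨ψ, ψ.continuous⟩ : C(b.carrier, b.carrier)) (φ x)) =
      (FundamentalGroup.map (⟨b.incl, b.continuous_incl⟩ : C(b.carrier, M))
        ((⟨ψ, ψ.continuous⟩ : C(b.carrier, b.carrier)) (φ x))).ker) :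
    ((FundamentalGroup.map (⟨b.incl, b.continuous_incl⟩ : C(b.carrier, M)) x).ker).map
        (FundamentalGroup.map (⟨φ.trans ψ, (φ.trans ψ).continuous⟩ : C(b.carrier, b.carrier)) x) =
      (FundamentalGroup.map (⟨b.incl, b.continuous_incl⟩ : C(b.carrier, M))
        ((⟨φ.trans ψ, (φ.trans ψ).continuous⟩ : C(b.carrier, b.carrier)) x)).ker := by
  ext δ
  constructor
  · rintro ⟨γ, hγ, rfl⟩
    have h1 : FundamentalGroup.map (⟨φ, φ.continuous⟩ : C(b.carrier, b.carrier)) x γ ∈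
        (FundamentalGroup.map (⟨b.incl, b.continuous_incl⟩ : C(b.carrier, M))
          ((⟨φ, φ.continuous⟩ : C(b.carrier, b.carrier)) x)).ker := by
      rw [← hφ]; exact Subgroup.mem_map_of_mem _ hγ
    have h2 : FundamentalGroup.map (⟨ψ, ψ.continuous⟩ : C(b.carrier, b.carrier)) (φ x)
        (FundamentalGroup.map (⟨φ, φ.continuous⟩ : C(b.carrier, b.carrier)) x γ) ∈
        (FundamentalGroup.map (⟨b.incl, b.continuous_incl⟩ : C(b.carrier, M))
          ((⟨ψ, ψ.continuous⟩ : C(b.carrier, b.carrier)) (φ x))).ker := by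
      rw [← hψ]; exact Subgroup.mem_map_of_mem _ h1
    have e : FundamentalGroup.map (⟨φ.trans ψ, (φ.trans ψ).continuous⟩ : C(b.carrier, b.carrier)) x γ =
        FundamentalGroup.map (⟨ψ, ψ.continuous⟩ : C(b.carrier, b.carrier)) (φ x)
          (FundamentalGroup.map (⟨φ, φ.continuous⟩ : C(b.carrier, b.carrier)) x γ) :=
      fundamentalGroup_map_comp_apply (⟨φ, φ.continuous⟩ : C(b.carrier, b.carrier))
        (⟨ψ, ψ.continuous⟩ : C(b.carrier, b.carrier)) x γ
    show FundamentalGroup.map (⟨b.incl, b.continuous_incl⟩ : C(b.carrier, M)) _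
      (FundamentalGroup.map (⟨φ.trans ψ, (φ.trans ψ).continuous⟩ : C(b.carrier, b.carrier)) x γ) = 1
    rw [e]
    exact (MonoidHom.mem_ker).1 h2
  · intro hδ
    have hδ' : δ ∈ ((FundamentalGroup.map (⟨b.incl, b.continuous_incl⟩ : C(b.carrier, M)) (φ x)).ker).map
        (FundamentalGroup.map (⟨ψ, ψ.continuous⟩ : C(b.carrier, b.carrier)) (φ x)) := by
      rw [hψ]; exact hδ
    obtain ⟨ε, hε, rfl⟩ := hδ'
    have hε' : ε ∈ ((FundamentalGroup.map (⟨b.incl, b.continuous_incl⟩ : C(b.carrier, M)) x).ker).map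
        (FundamentalGroup.map (⟨φ, φ.continuous⟩ : C(b.carrier, b.carrier)) x) := by
      rw [hφ]; exact hε
    obtain ⟨γ, hγ, rfl⟩ := hε'
    exact ⟨γ, hγ, fundamentalGroup_map_comp_apply (⟨φ, φ.continuous⟩ : C(b.carrier, b.carrier))
      (⟨ψ, ψ.continuous⟩ : C(b.carrier, b.carrier)) x γ⟩

/-- **Based form of the kernel condition.**  If `f` fixes `x` up to the equation `hy : f x = y`
and `f_*` carries `ker i_*` at `x` onto `ker i_*` at `f x`, then the based homomorphism
`mapOfEq f hy : π₁(X, x) → π₁(X, y)` carries `ker i_*` at `x` onto `ker i_*` at `y`. [folklore] -/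
theorem map_ker_mapOfEq_eq {X Y : Type*} [TopologicalSpace X] [TopologicalSpace Y]
    (i : C(X, Y)) (f : C(X, X)) {x y : X} (hy : f x = y)
    (h : ((FundamentalGroup.map i x).ker).map (FundamentalGroup.map f x) = (FundamentalGroup.map i (f x)).ker) :
    ((FundamentalGroup.map i x).ker).map (FundamentalGroup.mapOfEq f hy) = (FundamentalGroup.map i y).ker := by
  subst hy
  have e : FundamentalGroup.mapOfEq f (rfl : f x = f x) = FundamentalGroup.map f x :=
    MonoidHom.ext fun γ => mapOfEq_rfl_apply f x γ
  rw [e]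
  exact h

/-- A based automorphism preserving a subgroup has inverse preserving it. [folklore] -/
theorem Subgroup.map_symm_eq_of_map_eq {G : Type*} [Group G] (K : Subgroup G) (Θ : G ≃* G)
    (h : K.map Θ.toMonoidHom = K) : K.map Θ.symm.toMonoidHom = K := by
  have hid : Θ.symm.toMonoidHom.comp Θ.toMonoidHom = MonoidHom.id G := MonoidHom.ext fun g => by simp
  calc K.map Θ.symm.toMonoidHom = (K.map Θ.toMonoidHom).map Θ.symm.toMonoidHom := by rw [h]
    _ = K.map (Θ.symm.toMonoidHom.comp Θ.toMonoidHom) := Subgroup.map_map _ _ _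
    _ = K := by rw [hid, Subgroup.map_id]

end KernelCondition

/-! ### §2 Realisation of kernel-preserving automorphisms of `π₁(∂V, z₀)` by extendable diffeomorphisms -/

namespace RoundSolidTorusModel

open Literature.Topology.Euclidean

/-- **The constructive half of Griffiths' theorem in genus one.**  Every automorphism `Θ` of
`π₁(∂V, z₀)` (`V` the round solid torus) that carries the kernel `ker (π₁(∂V, z₀) → π₁(V, z₀))`
onto itself is induced by a diffeomorphism `F` of `∂V` fixing `z₀` WHICH EXTENDS OVER `V`: its
matrix `(a b; c d)` in the basis (longitude, meridian) of `π₁(∂V, z₀) ≅ ℤ²` has `b = 0` (the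
meridian generates the kernel, `ker_map_incl_eq_zpowers_meridianClass`) and `a, d = ±1`, and the
linear diffeomorphism `M_{(a 0; c d)}` realises `Θ` (`mapOfEq_boundaryMatrixFun`) and extends
(`diffeoExtends_boundaryMatrixDiffeo`: meridional twists and the mirror).  Griffiths (1964), main
theorem, genus `1`; Farb–Margalit (2012), §2.2.4 (linear maps of `T²`).
[cite: GriffithsHB1964Handlebody, main theorem (genus 1)] -/
theorem exists_diffeoExtends_mapOfEq_eq
    (Θ : FundamentalGroup ((𝓡∂ 3).boundary RoundSolidTorus) basePt ≃*
      FundamentalGroup ((𝓡∂ 3).boundary RoundSolidTorus) basePt)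
    (hΘ : ((FundamentalGroup.map bdryIncl basePt).ker).map Θ.toMonoidHom =
      (FundamentalGroup.map bdryIncl basePt).ker) :
    ∃ (F : (𝓡∂ 3).boundary RoundSolidTorus ≃ₘ⟮𝓡 2, 𝓡 2⟯ (𝓡∂ 3).boundary RoundSolidTorus)
      (hF : F basePt = basePt),
      (BoundaryManifold.boundaryData 2 RoundSolidTorus).DiffeoExtends F ∧
        ∀ γ, FundamentalGroup.mapOfEq (⟨F, F.continuous⟩ : C(_, _)) hF γ = Θ γ := by
  have hp : (2 * Real.pi : ℝ) ≠ 0 := Real.two_pi_pos.ne'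
  set Hc := Homeomorph.fundamentalGroupCongr boundaryHomeomorphAddCircle
    boundaryHomeomorphAddCircle_basePt with hHc
  set Θ' := Hc.symm.trans (Θ.trans Hc) with hΘ'
  obtain ⟨hrel, hrel'⟩ := torusAutCoord_relations hp Θ'
  set a := (torusAutCoord hp Θ'.toMonoidHom (1, 0)).1
  set c := (torusAutCoord hp Θ'.toMonoidHom (1, 0)).2
  set b := (torusAutCoord hp Θ'.toMonoidHom (0, 1)).1
  set d := (torusAutCoord hp Θ'.toMonoidHom (0, 1)).2
  set a' := (torusAutCoord hp Θ'.symm.toMonoidHom (1, 0)).1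
  set c' := (torusAutCoord hp Θ'.symm.toMonoidHom (1, 0)).2
  set b' := (torusAutCoord hp Θ'.symm.toMonoidHom (0, 1)).1
  set d' := (torusAutCoord hp Θ'.symm.toMonoidHom (0, 1)).2
  -- the kernel is `⟨g₂⟩`; `Θ g₂ = g₂ ^ k` and `Θ⁻¹ g₂ = g₂ ^ k'`
  have hK := ker_map_incl_eq_zpowers_meridianClass
  have hΘsymm := Subgroup.map_symm_eq_of_map_eq _ Θ hΘ
  have hmem : ∀ (Ψ : FundamentalGroup ((𝓡∂ 3).boundary RoundSolidTorus) basePt ≃*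
      FundamentalGroup ((𝓡∂ 3).boundary RoundSolidTorus) basePt),
      ((FundamentalGroup.map bdryIncl basePt).ker).map Ψ.toMonoidHom =
        (FundamentalGroup.map bdryIncl basePt).ker → ∃ k : ℤ, meridianClass ^ k = Ψ meridianClass := by
    intro Ψ hΨ
    have h1 : Ψ meridianClass ∈ (FundamentalGroup.map bdryIncl basePt).ker := by
      rw [← hΨ]; exact Subgroup.mem_map_of_mem _ meridianClass_mem_ker
    rw [hK, Subgroup.mem_zpowers_iff] at h1
    exact h1
  obtain ⟨k, hk⟩ := hmem Θ hΘ
  obtain ⟨k', hk'⟩ := hmem Θ.symm hΘsymm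
  have hΘ'g : Θ' (torusLoop₂ (2 * Real.pi)) = torusLoop₂ (2 * Real.pi) ^ k := by
    rw [hΘ', MulEquiv.trans_apply, MulEquiv.trans_apply,
      show Hc.symm (torusLoop₂ (2 * Real.pi)) = meridianClass from rfl, ← hk, map_zpow]
    exact congrArg (· ^ k) congrTorus_meridianClass
  have hΘ'symm_g : Θ'.symm (torusLoop₂ (2 * Real.pi)) = torusLoop₂ (2 * Real.pi) ^ k' := by
    have e : Θ'.symm (torusLoop₂ (2 * Real.pi)) = Hc (Θ.symm (Hc.symm (torusLoop₂ (2 * Real.pi)))) := by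
      rw [hΘ']; rfl
    rw [e, show Hc.symm (torusLoop₂ (2 * Real.pi)) = meridianClass from rfl, ← hk', map_zpow]
    exact congrArg (· ^ k') congrTorus_meridianClass
  -- hence `b = 0 = b'`
  have hb : b = 0 := by
    show (torusAutCoord hp Θ'.toMonoidHom (0, 1)).1 = 0
    rw [torusAutCoord_apply, fundamentalGroupTorusEquiv_symm_ofAdd, zpow_zero, zpow_one, one_mul,
      MulEquiv.coe_toMonoidHom, hΘ'g, ← one_mul (torusLoop₂ (2 * Real.pi) ^ k),
      ← zpow_zero (torusLoop₁ (2 * Real.pi)), fundamentalGroupTorusEquiv_zpow_mul_zpow]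
    rfl
  have hb' : b' = 0 := by
    show (torusAutCoord hp Θ'.symm.toMonoidHom (0, 1)).1 = 0
    rw [torusAutCoord_apply, fundamentalGroupTorusEquiv_symm_ofAdd, zpow_zero, zpow_one, one_mul,
      MulEquiv.coe_toMonoidHom, hΘ'symm_g, ← one_mul (torusLoop₂ (2 * Real.pi) ^ k'),
      ← zpow_zero (torusLoop₁ (2 * Real.pi)), fundamentalGroupTorusEquiv_zpow_mul_zpow]
    rfl
  -- hence `a, d = ±1`
  have ha : a = 1 ∨ a = -1 := by
    have h1 : a' * a + b' * c = 1 := hrel.1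
    rw [hb', zero_mul, add_zero] at h1
    rcases Int.eq_one_or_neg_one_of_mul_eq_one' h1 with ⟨-, h⟩ | ⟨-, h⟩
    · exact Or.inl h
    · exact Or.inr h
  have hd : d = 1 ∨ d = -1 := by
    have h4 : c' * b + d' * d = 1 := hrel.2.2.2
    rw [hb, mul_zero, zero_add] at h4
    rcases Int.eq_one_or_neg_one_of_mul_eq_one' h4 with ⟨-, h⟩ | ⟨-, h⟩
    · exact Or.inl h
    · exact Or.inr h
  -- the linear diffeomorphism realises `Θ'` and extends
  have hM : ∀ δ, FundamentalGroup.mapOfEq (torusMatrixMap (2 * Real.pi) a b c d)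
      (torusMatrixMap_zero a b c d) δ = Θ' δ := fun δ => by
    have h := eq_mapOfEq_torusMatrixMap hp Θ'.toMonoidHom
    exact (DFunLike.congr_fun h δ).symm
  refine ⟨boundaryMatrixDiffeo a b c d a' b' c' d' hrel hrel', boundaryMatrixFun_basePt a b c d,
    diffeoExtends_boundaryMatrixDiffeo a b c d a' b' c' d' ha hb hd hrel hrel', fun γ => ?_⟩
  have h1 := mapOfEq_boundaryMatrixFun a b c d γ
  rw [hM] at h1
  rw [← hHc] at h1
  calc FundamentalGroup.mapOfEq (⟨⇑(boundaryMatrixDiffeo a b c d a' b' c' d' hrel hrel'),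
          (boundaryMatrixDiffeo a b c d a' b' c' d' hrel hrel').continuous⟩ : C(_, _))
          (boundaryMatrixFun_basePt a b c d) γ
      = FundamentalGroup.mapOfEq ⟨boundaryMatrixFun a b c d, continuous_boundaryMatrixFun a b c d⟩
          (boundaryMatrixFun_basePt a b c d) γ := rfl
    _ = Hc.symm (Θ' (Hc γ)) := h1
    _ = Θ γ := by rw [hΘ']; simp

/-! ### §3 Griffiths' criterion on the model from the faithfulness of `Diff(∂V)` on `π₁` -/

/-- **Griffiths' theorem for the round solid torus, from the faithfulness of the action of
`Diff(T²)` on `π₁(T²)`.**  Hypothesis (F): every self-diffeomorphism `τ` of the Heegaard torus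
`∂V` fixing the base point `z₀` and inducing the identity of `π₁(∂V, z₀)` is diffeotopic to the
identity (Farb–Margalit (2012), Thm. 2.5: `Mod(T²) → SL(2, ℤ)` is injective; Thm. 1.13: smooth =
topological mapping classes).  Conclusion: every self-diffeomorphism `χ` of `∂V` satisfying
Griffiths' kernel condition at some base point extends to a self-diffeomorphism of `V`
(`BoundaryData.DiffeoExtends` for `BoundaryManifold.boundaryData 2 V`).  Proof: normalise `χ` to
`ψ = P₂ ∘ χ ∘ P₁` fixing `z₀` by diffeotopies (which extend, collar absorption, and are therefore
kernel-preserving); realise `ψ_#` by an extendable linear diffeomorphism `F` (§2); `ψ ∘ F⁻¹`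
acts trivially on `π₁`, so is diffeotopic to the identity by (F) and extends; compose.
[cite: GriffithsHB1964Handlebody, main theorem (genus 1)] [cite: FarbMargalit2012, Thm. 2.5] -/
theorem diffeoExtends_of_map_ker_eq_ker_of_faithful
    (hF : ∀ (τ : (𝓡∂ 3).boundary RoundSolidTorus ≃ₘ⟮𝓡 2, 𝓡 2⟯ (𝓡∂ 3).boundary RoundSolidTorus)
      (hτ : τ basePt = basePt),
      (∀ γ, FundamentalGroup.mapOfEq (⟨τ, τ.continuous⟩ : C(_, _)) hτ γ = γ) →
        Diffeomorph.IsDiffeotopicToId τ)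
    (χ : (𝓡∂ 3).boundary RoundSolidTorus ≃ₘ⟮𝓡 2, 𝓡 2⟯ (𝓡∂ 3).boundary RoundSolidTorus)
    (y₀ : (𝓡∂ 3).boundary RoundSolidTorus)
    (hker : ((FundamentalGroup.map bdryIncl y₀).ker).map
        (FundamentalGroup.map (⟨χ, χ.continuous⟩ : C(_, _)) y₀)
      = (FundamentalGroup.map bdryIncl ((⟨χ, χ.continuous⟩ : C(_, _)) y₀)).ker) :
    (BoundaryManifold.boundaryData 2 RoundSolidTorus).DiffeoExtends χ := by
  haveI : ConnectedSpace ((𝓡∂ 3).boundary RoundSolidTorus) :=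
    IsHandlebody.connectedSpace_boundary_holds 1 RoundSolidTorus isHandlebody_one_roundSolidTorus
      (BoundaryManifold.boundaryData 2 RoundSolidTorus)
  -- Step 1: move the base points to `z₀` by diffeotopies
  obtain ⟨P₁, hP₁, hP₁x⟩ := Diffeomorph.exists_isDiffeotopicToId_apply_eq_euclidean 2
    ((𝓡∂ 3).boundary RoundSolidTorus) basePt y₀
  obtain ⟨P₂, hP₂, hP₂x⟩ := Diffeomorph.exists_isDiffeotopicToId_apply_eq_euclidean 2
    ((𝓡∂ 3).boundary RoundSolidTorus) (χ y₀) basePt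
  have hE₁ : (BoundaryManifold.boundaryData 2 RoundSolidTorus).DiffeoExtends P₁ :=
    BoundaryData.diffeoExtends_of_isDiffeotopicToId_holds 2 RoundSolidTorus
      (BoundaryManifold.boundaryData 2 RoundSolidTorus) P₁ hP₁
  have hE₂ : (BoundaryManifold.boundaryData 2 RoundSolidTorus).DiffeoExtends P₂ :=
    BoundaryData.diffeoExtends_of_isDiffeotopicToId_holds 2 RoundSolidTorus
      (BoundaryManifold.boundaryData 2 RoundSolidTorus) P₂ hP₂
  have hψx : ((P₁.trans χ).trans P₂) basePt = basePt := by
    show P₂ (χ (P₁ basePt)) = basePt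
    rw [hP₁x, hP₂x]
  -- the kernel condition for `ψ = P₂ ∘ χ ∘ P₁` at `z₀`
  have hkχ : ((FundamentalGroup.map bdryIncl (P₁ basePt)).ker).map
        (FundamentalGroup.map (⟨χ, χ.continuous⟩ : C(_, _)) (P₁ basePt)) =
      (FundamentalGroup.map bdryIncl ((⟨χ, χ.continuous⟩ : C(_, _)) (P₁ basePt))).ker := by
    rw [hP₁x]; exact hker
  have hkψ := (BoundaryManifold.boundaryData 2 RoundSolidTorus).map_ker_trans
    ((BoundaryManifold.boundaryData 2 RoundSolidTorus).map_ker_trans (hE₁.map_ker_eq_ker basePt) hkχ)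
    (hE₂.map_ker_eq_ker ((P₁.trans χ) basePt))
  -- Step 2: the based automorphism `Θ = ψ_#` preserves the kernel; realise it by an extendable `F`
  have hΘ : ((FundamentalGroup.map bdryIncl basePt).ker).map
      (Homeomorph.fundamentalGroupCongr ((P₁.trans χ).trans P₂).toHomeomorph hψx).toMonoidHom =
      (FundamentalGroup.map bdryIncl basePt).ker := by
    have h := map_ker_mapOfEq_eq bdryIncl
      (⟨(P₁.trans χ).trans P₂, ((P₁.trans χ).trans P₂).continuous⟩ : C(_, _)) hψx hkψ
    have e : (Homeomorph.fundamentalGroupCongr ((P₁.trans χ).trans P₂).toHomeomorph hψx).toMonoidHom =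
        FundamentalGroup.mapOfEq
          (⟨(P₁.trans χ).trans P₂, ((P₁.trans χ).trans P₂).continuous⟩ : C(_, _)) hψx :=
      MonoidHom.ext fun _ => rfl
    rw [e]; exact h
  obtain ⟨F, hFx, hFext, hFΘ⟩ := exists_diffeoExtends_mapOfEq_eq _ hΘ
  -- Step 3: `τ = ψ ∘ F⁻¹` acts trivially, hence is diffeotopic to the identity, hence extends
  have hFsx : F.symm basePt = basePt := by
    calc F.symm basePt = F.symm (F basePt) := by rw [hFx]
      _ = basePt := F.symm_apply_apply _
  have hτx : (F.symm.trans ((P₁.trans χ).trans P₂)) basePt = basePt := by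
    show ((P₁.trans χ).trans P₂) (F.symm basePt) = basePt
    rw [hFsx, hψx]
  have hτ : ∀ γ, FundamentalGroup.mapOfEq (⟨F.symm.trans ((P₁.trans χ).trans P₂),
      (F.symm.trans ((P₁.trans χ).trans P₂)).continuous⟩ : C(_, _)) hτx γ = γ := by
    intro γ
    have e1 := mapOfEq_comp_apply (⟨F.symm, F.symm.continuous⟩ : C(_, _))
      (⟨(P₁.trans χ).trans P₂, ((P₁.trans χ).trans P₂).continuous⟩ : C(_, _)) hFsx hψx γ
    have e2 : FundamentalGroup.mapOfEq (⟨F.symm, F.symm.continuous⟩ : C(_, _)) hFsx γ =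
        (Homeomorph.fundamentalGroupCongr ((P₁.trans χ).trans P₂).toHomeomorph hψx).symm γ := by
      apply (Homeomorph.fundamentalGroupCongr ((P₁.trans χ).trans P₂).toHomeomorph hψx).injective
      rw [MulEquiv.apply_symm_apply, ← hFΘ, ← mapOfEq_comp_apply]
      exact FundamentalGroup.mapOfEq_apply_eq_self_of_forall_eq _ (fun z => F.apply_symm_apply z) γ
    refine e1.trans ?_
    rw [e2]
    exact (Homeomorph.fundamentalGroupCongr ((P₁.trans χ).trans P₂).toHomeomorph hψx).apply_symm_apply γ
  have hτiso : Diffeomorph.IsDiffeotopicToId (F.symm.trans ((P₁.trans χ).trans P₂)) := hF _ hτx hτ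
  have hτext : (BoundaryManifold.boundaryData 2 RoundSolidTorus).DiffeoExtends
      (F.symm.trans ((P₁.trans χ).trans P₂)) :=
    BoundaryData.diffeoExtends_of_isDiffeotopicToId_holds 2 RoundSolidTorus
      (BoundaryManifold.boundaryData 2 RoundSolidTorus) _ hτiso
  -- Step 4: compose back
  have hψext : (BoundaryManifold.boundaryData 2 RoundSolidTorus).DiffeoExtends ((P₁.trans χ).trans P₂) := by
    have h := hFext.trans hτext
    have e : F.trans (F.symm.trans ((P₁.trans χ).trans P₂)) = (P₁.trans χ).trans P₂ :=
      Diffeomorph.ext fun z => by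
        simp only [Diffeomorph.coe_trans, Function.comp_apply, Diffeomorph.symm_apply_apply]
    convert h using 2
    exact e.symm
  have h := (hE₁.symm.trans hψext).trans hE₂.symm
  have e : (P₁.symm.trans ((P₁.trans χ).trans P₂)).trans P₂.symm = χ := Diffeomorph.ext fun z => by
    simp only [Diffeomorph.coe_trans, Function.comp_apply, Diffeomorph.apply_symm_apply,
      Diffeomorph.symm_apply_apply]
  convert h using 2
  exact e.symm

end RoundSolidTorusModel

/-! ### §4 Genus one of `GriffithsExtension`, granted the faithfulness of `Mod(T²)` -/

open RoundSolidTorusModel in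
/-- **Griffiths' handlebody extension theorem in genus one, from the faithfulness of `Mod(T²)` on
`π₁`.**  Granted (F) — every self-diffeomorphism of the Heegaard torus `∂V` of the round solid
torus fixing `z₀` and acting as the identity on `π₁(∂V, z₀)` is diffeotopic to the identity
(Farb–Margalit (2012), Thm. 2.5 with Thm. 1.13) — every kernel-preserving self-diffeomorphism of
ANY boundary datum of ANY genus-`1` handlebody extends over it: the criterion on the model (§3) is
transported along the classification of genus-`1` handlebodies
(`BoundaryData.diffeoExtends_of_forall_diffeoExtends_of_diffeomorph`).  This is the `g = 1` clause
of `GriffithsExtension` (Griffiths (1964), main theorem; Hensel (2020), Cor. 5.11), closed modulo (F).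
[cite: GriffithsHB1964Handlebody, main theorem (genus 1)] [cite: FarbMargalit2012, Thm. 2.5] -/
theorem griffithsExtension_genus_one_of_faithful
    (hF : ∀ (τ : (𝓡∂ 3).boundary RoundSolidTorus ≃ₘ⟮𝓡 2, 𝓡 2⟯ (𝓡∂ 3).boundary RoundSolidTorus)
      (hτ : τ basePt = basePt),
      (∀ γ, FundamentalGroup.mapOfEq (⟨τ, τ.continuous⟩ : C(_, _)) hτ γ = γ) →
        Diffeomorph.IsDiffeotopicToId τ)
    (H : Type) [TopologicalSpace H] [T2Space H] [SecondCountableTopology H]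
    [ChartedSpace (EuclideanHalfSpace 3) H] [IsManifold (𝓡∂ 3) ∞ H]
    (hH : IsHandlebody 1 H) (b : BoundaryData (𝓡∂ 3) H (𝓡 2))
    (ψ : b.carrier ≃ₘ⟮𝓡 2, 𝓡 2⟯ b.carrier) (x₀ : b.carrier)
    (hker : ((FundamentalGroup.map (⟨b.incl, b.continuous_incl⟩ : C(b.carrier, H)) x₀).ker).map
        (FundamentalGroup.map (⟨ψ, ψ.continuous⟩ : C(b.carrier, b.carrier)) x₀)
      = (FundamentalGroup.map (⟨b.incl, b.continuous_incl⟩ : C(b.carrier, H))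
          ((⟨ψ, ψ.continuous⟩ : C(b.carrier, b.carrier)) x₀)).ker) :
    b.DiffeoExtends ψ := by
  obtain ⟨Θ⟩ := IsHandlebody.nonempty_diffeomorph_of_oneHandle oneHandle_nonempty_diffeomorph_holds
    1 H RoundSolidTorus hH isHandlebody_one_roundSolidTorus
  exact b.diffeoExtends_of_forall_diffeoExtends_of_diffeomorph (BoundaryManifold.boundaryData 2 RoundSolidTorus)
    Θ (fun χ y₀ hk => diffeoExtends_of_map_ker_eq_ker_of_faithful hF χ y₀ hk) ψ x₀ hker

open RoundSolidTorusModel in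
/-- **`GriffithsExtension` from the faithfulness of `Mod(T²)` and the criterion on the flower
handlebodies.**  With (F) the genus-`1` hypothesis `h₁` of
`griffithsExtension_of_roundSolidTorus_of_flower` is discharged (§3), so the named fact
`Literature.Topology.FourManifolds.GriffithsExtension` follows from (F) together with Griffiths'
criterion on the flower handlebodies `FlowerModel.FlowerHandlebody` of genus `g ≥ 2` (where the
classical proof needs Dehn's lemma / the Dehn–Nielsen–Baer theorem; Hensel (2020), Lemma 5.10 and
Cor. 5.11). [cite: Hensel2020HandlebodyPrimer, Cor. 5.11 and Lemma 5.10] -/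
theorem griffithsExtension_of_faithful_of_flower
    (hF : ∀ (τ : (𝓡∂ 3).boundary RoundSolidTorus ≃ₘ⟮𝓡 2, 𝓡 2⟯ (𝓡∂ 3).boundary RoundSolidTorus)
      (hτ : τ basePt = basePt),
      (∀ γ, FundamentalGroup.mapOfEq (⟨τ, τ.continuous⟩ : C(_, _)) hτ γ = γ) →
        Diffeomorph.IsDiffeotopicToId τ)
    (h₂ : ∀ (g : ℕ) (hg : 2 ≤ g)
      (χ : (BoundaryManifold.boundaryData 2 (FlowerModel.FlowerHandlebody hg)).carrier ≃ₘ⟮𝓡 2, 𝓡 2⟯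
        (BoundaryManifold.boundaryData 2 (FlowerModel.FlowerHandlebody hg)).carrier)
      (y₀ : (BoundaryManifold.boundaryData 2 (FlowerModel.FlowerHandlebody hg)).carrier),
      ((FundamentalGroup.map (⟨(BoundaryManifold.boundaryData 2 (FlowerModel.FlowerHandlebody hg)).incl,
          (BoundaryManifold.boundaryData 2 (FlowerModel.FlowerHandlebody hg)).continuous_incl⟩ :
            C((BoundaryManifold.boundaryData 2 (FlowerModel.FlowerHandlebody hg)).carrier,
              FlowerModel.FlowerHandlebody hg)) y₀).ker).map
          (FundamentalGroup.map (⟨χ, χ.continuous⟩ : C(_, _)) y₀)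
        = (FundamentalGroup.map (⟨(BoundaryManifold.boundaryData 2 (FlowerModel.FlowerHandlebody hg)).incl,
            (BoundaryManifold.boundaryData 2 (FlowerModel.FlowerHandlebody hg)).continuous_incl⟩ :
              C((BoundaryManifold.boundaryData 2 (FlowerModel.FlowerHandlebody hg)).carrier,
                FlowerModel.FlowerHandlebody hg))
            ((⟨χ, χ.continuous⟩ : C(_, _)) y₀)).ker →
      (BoundaryManifold.boundaryData 2 (FlowerModel.FlowerHandlebody hg)).DiffeoExtends χ) :
    GriffithsExtension :=
  griffithsExtension_of_roundSolidTorus_of_flower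
    (fun χ y₀ hk => diffeoExtends_of_map_ker_eq_ker_of_faithful hF χ y₀ hk) h₂

end Literature.Topology.FourManifolds

end
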